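import Summits.BirchSwinnertonDyer.BirchSwinnertonDyer.Theorems.ByReductionTypeAtTwoRankOneAtTwoBigImageOddLocalOneDoorFull
import Summits.BirchSwinnertonDyer.BirchSwinnertonDyer.Theorems.ByReductionTypeAtTwoRankOneAtTwoBigImageOddLocalOneDoorTamagawa
import HarnessLib

/-!
# Route ByReductionTypeAtTwo, crux `RankOneAtTwoBigImageOddLocal` (stmt-BirchSwinnertonDyer-23715), lines `one_door_law` (v7.3) /
# `one_door_analytic` (v8): the TWIN VALUE LAW with `s_d = ord₂ #Ш(E^{(d)})[2^∞]` floating, and the value stub WITHOUT the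
# Tamagawa hypothesis

Width seat `bsd-line-fkl-p2` g6 (2026-08-28), sequel of `…OneDoorTamagawa.lean` (p616165: the Tamagawa receptacle
`DoorTwistTamagawaAtTwo` is a theorem).  Two consequences, kernel only:

* `doorTwistValueAtTwo_of_converse` / `…_of_converse_of_rankZero_cruxes` — the lead's `doorTwistValueAtTwo_of` (p614641) with its
  hypothesis `DoorTwistTamagawaAtTwo` DISCHARGED: `hasEntireLFunction_rat → DoorTwistConverseAtTwo → DoorTwistBSDTwoAtTwo →
  DoorTwistValueAtTwo` (so the skeleton's derived `stub_doorValue` needs three stubs, not four).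
* `doorTwinValue_at` / `doorTwinValueAtTwo_of_rankZeroTwin` / `…_of_rankZero_cruxes` — the TWIN VALUE LAW of the analytic line v8
  (`Lines/one_door_analytic.lean`, -an g11, stub `stub_twinArith : S_pub → S_rankZeroTwin → DoorTwinValueAtTwo`), whose body is
  restated here VERBATIM with explicit binders (the v8 Props are not tree declarations yet): for `W` non-CM with `E(ℚ)[2] = 0`, a
  door-admissible `d` with `L(W^{(d)},1) ≠ 0` and a globally minimal `Wd = Cd • W^{(d)}` satisfying `BSD(Wd,2)` — in particular
  for every such `Wd` once the route's four rank-`0` cruxes hold — `Ш(Wd)[2^∞]` is finite and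
  `L(Wd,1)/Ω(Wd) = q_d ∈ ℚ^×` with `ord₂ q_d = ord₂ ∏c_ℓ(W) + t + 2s + ord₂ #Ш(Wd)[2^∞]`.
  Ingredients: `L(Wd,·) = L(W^{(d)},·)` (`entireLFunction_smul`), analytic rank `0` (modularity), `BSD(Wd,2)` unpacked in rank
  `0` (`leadingLCoeff = L(Wd,1)`, `Reg = 1`), `Wd(ℚ)[2] = 0` (`Uniform.U2.torsionBy_two_eq_bot_of_twist`) hence `#T` odd, and
  `ord₂ ∏c_ℓ(Wd) = ord₂ ∏c_ℓ(W) + t + 2s` (`doorTwistTamagawaAtTwo`) — the lead's computation in `…OneDoorFull.lean`, isolated.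

BSD is not proved by any of this: `DoorTwistConverseAtTwo`, the route's rank-`0` cruxes, `DoorIndexLawAtTwo` and the published
inputs remain hypotheses / open statements.
-/

set_option autoImplicit false
set_option linter.dupNamespace false

noncomputable section

open scoped Classical

namespace Summit.BirchSwinnertonDyer.BirchSwinnertonDyer.Theorems.RankOneAtTwoOneDoor

open WeierstrassCurve NumberField Literature.NumberTheory.EllipticCurves
  Literature.NumberTheory.EllipticCurves.ModularForms
  Summit.BirchSwinnertonDyer.Rank1Residual.F1Sign2
  Summit.BirchSwinnertonDyer.Rank1Residual.F1Sign2.TranspositionDoor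
  Summit.BirchSwinnertonDyer.BirchSwinnertonDyer.Theses.ByReductionTypeAtTwo
  Summit.BirchSwinnertonDyer.Rank1Residual

/-! ### §1 The value stub and the full door law without the Tamagawa hypothesis -/

/-- **The value stub from (V1) and (V2) only**: `hasEntireLFunction_rat → DoorTwistConverseAtTwo → DoorTwistBSDTwoAtTwo →
DoorTwistValueAtTwo` — the lead's `doorTwistValueAtTwo_of` with (V3) supplied by the theorem `doorTwistTamagawaAtTwo`. -/
theorem doorTwistValueAtTwo_of_converse (hmod : hasEntireLFunction_rat) (hConv : DoorTwistConverseAtTwo)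
    (hBSD : DoorTwistBSDTwoAtTwo) : DoorTwistValueAtTwo :=
  doorTwistValueAtTwo_of hmod hConv hBSD doorTwistTamagawaAtTwo

/-- The value stub from modularity, the `2`-converse and the route's four rank-`0` cruxes BY NAME (no Tamagawa hypothesis). -/
theorem doorTwistValueAtTwo_of_converse_of_rankZero_cruxes (hmod : hasEntireLFunction_rat)
    (hConv : DoorTwistConverseAtTwo)
    (hR0 : GoodOrdinaryRankZeroAtTwo ∧ MultiplicativeRankZeroAtTwo ∧ SupersingularRankZeroAtTwo ∧ AdditiveRankZeroAtTwo) :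
    DoorTwistValueAtTwo :=
  doorTwistValueAtTwo_of_rankZero_cruxes hmod hConv hR0 doorTwistTamagawaAtTwo

/-! ### §2 The twin value law (`s_d` floating) at a datum satisfying `BSD(Wd, 2)` -/

/-- **Twin value law at a datum.**  `W/ℚ` globally minimal elliptic with `E(ℚ)[2] = 0`, `d` door-admissible with
`L(W^{(d)},1) ≠ 0`, `Wd = Cd • W^{(d)}` globally minimal with `BSD(Wd,2)`, modularity (`hasEntireLFunction_rat`, for the analytic
rank of `Wd`).  THEN `Ш(Wd)[2^∞]` is finite and `L(Wd,1)/Ω(Wd) = q_d` with `q_d ∈ ℚ^×`,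
`ord₂ q_d = ord₂ ∏c_ℓ(W) + t + 2s + ord₂ #Ш(Wd)[2^∞]` (rank-`0` unpacking of Miller's `BSD(Wd,2)`: `q_d = #Ш_an · ∏c_ℓ(Wd)/#T²`,
`#T` odd since `Wd(ℚ)[2] = 0`, and `ord₂ ∏c_ℓ(Wd) = ord₂ ∏c_ℓ(W) + t + 2s` by `doorTwistTamagawaAtTwo`).
[cite: Miller2011LMS, Def. 1.1] [cite: Kramer1981, Prop. 3] -/
theorem doorTwinValue_at (hmod : hasEntireLFunction_rat)
    (W : WeierstrassCurve ℚ) [W.IsElliptic] [W.IsGloballyMinimal] (hT2 : NoRationalTwoTorsion W)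
    (d : ℤ) (hadm : DoorAdmissible W d) (hLt : (W.quadraticTwist (d : ℚ)).entireLFunction 1 ≠ 0)
    (Wd : WeierstrassCurve ℚ) [Wd.IsElliptic] [Wd.IsGloballyMinimal] (Cd : VariableChange ℚ)
    (hWd : Cd • W.quadraticTwist (d : ℚ) = Wd) (hBd : BSDp Wd 2) :
    Finite (AddCommGroup.primaryComponent Wd.sha 2) ∧
      ∃ qd : ℚ, Wd.entireLFunction 1 / (Wd.realPeriodRat : ℂ) = (qd : ℂ) ∧ qd ≠ 0 ∧
        padicValRat 2 qd = padicValNat 2 W.tamagawaProduct + transpCount W d + 2 * identCount W d +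
          padicValNat 2 (Nat.card (AddCommGroup.primaryComponent Wd.sha 2)) := by
  haveI : Fact (Nat.Prime 2) := ⟨Nat.prime_two⟩
  have hD0 : (d : ℚ) ≠ 0 := by
    have : d < 0 := hadm.1
    exact_mod_cast this.ne
  haveI hEt : (W.quadraticTwist (d : ℚ)).IsElliptic := W.isElliptic_quadraticTwist hD0
  -- `L(Wd,1) ≠ 0`, analytic rank `0`, `BSD(Wd,2)` unpacked
  have hLeq : Wd.entireLFunction = (W.quadraticTwist (d : ℚ)).entireLFunction := by
    rw [← hWd, entireLFunction_smul]
  have hLd : Wd.entireLFunction 1 ≠ 0 := by rw [hLeq]; exact hLt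
  have hrd : Wd.analyticRank = 0 := (Wd.analyticRank_eq_zero_iff_holds (hmod Wd)).2 hLd
  obtain ⟨hrankd, hfind, q', hq', hv'⟩ := hBd
  haveI := hfind
  have hrkd : Wd.mordellWeilRank = 0 := by rw [hrankd, hrd]
  -- `Wd(ℚ)[2] = 0`, hence `#Wd(ℚ)_tors` odd
  have hW2 : ∀ T : W.toAffine.Point, 2 • T = 0 → T = 0 := EggDoubling.eq_zero_of_two_smul_eq_zero W hT2
  have hWd2 : ∀ T : Wd.toAffine.Point, 2 • T = 0 → T = 0 := by
    have hbotW : AddSubgroup.torsionBy W.toAffine.Point (2 : ℤ) = ⊥ :=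
      Summit.BirchSwinnertonDyer.Uniform.U2.torsionBy_two_eq_bot_iff.mpr hW2
    have hbotWd := Summit.BirchSwinnertonDyer.Uniform.U2.torsionBy_two_eq_bot_of_twist W hD0 Wd ⟨Cd⁻¹, by
      rw [← hWd, inv_smul_smul]⟩ hbotW
    exact Summit.BirchSwinnertonDyer.Uniform.U2.torsionBy_two_eq_bot_iff.mp hbotWd
  have hTdodd : Odd Wd.torsionOrder := odd_torsionOrder_of_two_smul_eq_zero Wd hWd2
  have hvTd : padicValNat 2 Wd.torsionOrder = 0 :=
    padicValNat.eq_zero_of_not_dvd (fun h => (Nat.not_even_iff_odd.mpr hTdodd) (even_iff_two_dvd.mpr h))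
  -- Tamagawa numbers (V3, a theorem)
  have hvTam : padicValNat 2 Wd.tamagawaProduct =
      padicValNat 2 W.tamagawaProduct + transpCount W d + 2 * identCount W d :=
    doorTwistTamagawaAtTwo W d hadm Wd Cd hWd
  -- Miller's `#Ш_an(Wd)` in rank `0`
  have hlead : Wd.leadingLCoeff = Wd.entireLFunction 1 :=
    WeierstrassCurve.leadingLCoeff_eq_of_analyticRank_eq_zero Wd hrd
  have hreg : Wd.regulator = 1 := Wd.regulator_eq_one_of_rank_zero hrkd
  have hΩdpos : 0 < Wd.realPeriodRat := Wd.realPeriodRat_pos_holds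
  have hΩdC : (Wd.realPeriodRat : ℂ) ≠ 0 := by exact_mod_cast hΩdpos.ne'
  have hTd0 : 0 < Wd.torsionOrder := Wd.torsionOrder_pos_holds
  have hcd0 : 0 < Wd.tamagawaProduct := Wd.tamagawaProduct_pos_holds
  set qd : ℚ := q' * Wd.tamagawaProduct / (Wd.torsionOrder : ℚ) ^ 2 with hqd_def
  have hsha := hq'
  rw [shaAn_def, hlead, hreg, Complex.ofReal_one, mul_one] at hsha
  have hqd : Wd.entireLFunction 1 / (Wd.realPeriodRat : ℂ) = (qd : ℂ) := by
    have hTC : (Wd.torsionOrder : ℂ) ≠ 0 := by exact_mod_cast hTd0.ne'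
    have hcC : (Wd.tamagawaProduct : ℂ) ≠ 0 := by exact_mod_cast hcd0.ne'
    have h1 : Wd.entireLFunction 1 * (Wd.torsionOrder : ℂ) ^ 2 =
        (q' : ℂ) * ((Wd.realPeriodRat : ℂ) * (Wd.tamagawaProduct : ℂ)) := by
      rw [← hsha]; field_simp
    rw [hqd_def]
    push_cast
    field_simp
    linear_combination h1
  have hq'0 : q' ≠ 0 := by
    intro h0
    apply hLd
    have := hqd
    rw [hqd_def, h0, zero_mul, zero_div, Rat.cast_zero, div_eq_zero_iff] at this
    rcases this with h | h
    · exact h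
    · exact absurd h hΩdC
  have hTq : (Wd.torsionOrder : ℚ) ≠ 0 := by exact_mod_cast hTd0.ne'
  have hcq : (Wd.tamagawaProduct : ℚ) ≠ 0 := by exact_mod_cast hcd0.ne'
  have hqd0 : qd ≠ 0 := by
    rw [hqd_def]
    exact div_ne_zero (mul_ne_zero hq'0 hcq) (pow_ne_zero _ hTq)
  refine ⟨hfind, qd, hqd, hqd0, ?_⟩
  rw [hqd_def, padicValRat.div (mul_ne_zero hq'0 hcq) (pow_ne_zero _ hTq), padicValRat.mul hq'0 hcq,
    padicValRat.pow, padicValRat.of_nat, padicValRat.of_nat, hv', hvTd, hvTam]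
  push_cast
  ring

/-! ### §3 The twin value law of LINE v8 `one_door_analytic` (stub `stub_twinArith`, body verbatim) -/

/-- **`S_rankZeroTwin → DoorTwinValueAtTwo` of `Lines/one_door_analytic.lean` (v8, -an g11), body VERBATIM**, from modularity:
rank-`0` `BSD₂` for every non-CM globally minimal curve of analytic rank `0` gives, for the door twist of a non-CM `W` with
`E(ℚ)[2] = 0` at a door with `L(W^{(d)},1) ≠ 0`, the twin value law with `s_d` floating (`doorTwinValue_at`; the twist is non-CM,
`RamifiedPairUpperBound.not_hasCM_of_smul_quadraticTwist_eq`). With `S_pub.2.2 = hasEntireLFunction_rat` this is v8's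
`stub_twinArith : S_pub → S_rankZeroTwin → DoorTwinValueAtTwo`. [cite: Miller2011LMS, Def. 1.1] -/
theorem doorTwinValueAtTwo_of_rankZeroTwin (hmod : hasEntireLFunction_rat)
    (hR0 : ∀ (V : WeierstrassCurve ℚ) [V.IsElliptic] [V.IsGloballyMinimal], ¬ V.HasCM → V.analyticRank = 0 → BSDp V 2) :
    ∀ (W : WeierstrassCurve ℚ) [W.IsElliptic] [W.IsGloballyMinimal], ¬ W.HasCM → NoRationalTwoTorsion W →
      ∀ (d : ℤ), DoorAdmissible W d → (W.quadraticTwist (d : ℚ)).entireLFunction 1 ≠ 0 →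
        ∀ (Wd : WeierstrassCurve ℚ) [Wd.IsElliptic] [Wd.IsGloballyMinimal] (Cd : WeierstrassCurve.VariableChange ℚ),
          Cd • W.quadraticTwist (d : ℚ) = Wd →
          Finite (AddCommGroup.primaryComponent Wd.sha 2) ∧
          ∃ qd : ℚ, Wd.entireLFunction 1 / (Wd.realPeriodRat : ℂ) = (qd : ℂ) ∧ qd ≠ 0 ∧
            padicValRat 2 qd = padicValNat 2 W.tamagawaProduct + transpCount W d + 2 * identCount W d +
              padicValNat 2 (Nat.card (AddCommGroup.primaryComponent Wd.sha 2)) := by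
  intro W _ _ hCM hT2 d hadm hLt Wd _ _ Cd hWd
  have hD0 : (d : ℚ) ≠ 0 := by
    have : d < 0 := hadm.1
    exact_mod_cast this.ne
  haveI hEt : (W.quadraticTwist (d : ℚ)).IsElliptic := W.isElliptic_quadraticTwist hD0
  have hLeq : Wd.entireLFunction = (W.quadraticTwist (d : ℚ)).entireLFunction := by
    rw [← hWd, entireLFunction_smul]
  have hLd : Wd.entireLFunction 1 ≠ 0 := by rw [hLeq]; exact hLt
  have hrd : Wd.analyticRank = 0 := (Wd.analyticRank_eq_zero_iff_holds (hmod Wd)).2 hLd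
  have hCMd : ¬ Wd.HasCM := RamifiedPairUpperBound.not_hasCM_of_smul_quadraticTwist_eq hD0 hWd hCM
  exact doorTwinValue_at hmod W hT2 d hadm hLt Wd Cd hWd (hR0 Wd hCMd hrd)

/-- The twin value law from modularity and the route's four rank-`0` cruxes BY NAME (`bsdp_two_of_rankZero_cruxes`). -/
theorem doorTwinValueAtTwo_of_rankZero_cruxes (hmod : hasEntireLFunction_rat)
    (hR0 : GoodOrdinaryRankZeroAtTwo ∧ MultiplicativeRankZeroAtTwo ∧ SupersingularRankZeroAtTwo ∧ AdditiveRankZeroAtTwo) :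
    ∀ (W : WeierstrassCurve ℚ) [W.IsElliptic] [W.IsGloballyMinimal], ¬ W.HasCM → NoRationalTwoTorsion W →
      ∀ (d : ℤ), DoorAdmissible W d → (W.quadraticTwist (d : ℚ)).entireLFunction 1 ≠ 0 →
        ∀ (Wd : WeierstrassCurve ℚ) [Wd.IsElliptic] [Wd.IsGloballyMinimal] (Cd : WeierstrassCurve.VariableChange ℚ),
          Cd • W.quadraticTwist (d : ℚ) = Wd →
          Finite (AddCommGroup.primaryComponent Wd.sha 2) ∧
          ∃ qd : ℚ, Wd.entireLFunction 1 / (Wd.realPeriodRat : ℂ) = (qd : ℂ) ∧ qd ≠ 0 ∧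
            padicValRat 2 qd = padicValNat 2 W.tamagawaProduct + transpCount W d + 2 * identCount W d +
              padicValNat 2 (Nat.card (AddCommGroup.primaryComponent Wd.sha 2)) :=
  doorTwinValueAtTwo_of_rankZeroTwin hmod fun V _ _ hCM hr => bsdp_two_of_rankZero_cruxes hR0 V hCM hr

end Summit.BirchSwinnertonDyer.BirchSwinnertonDyer.Theorems.RankOneAtTwoOneDoor

end
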